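import Summits.BirchSwinnertonDyer.BirchSwinnertonDyer.Theorems.PrintCFramBottomClassIndexLawFiveLeGenusInternalHeegnerSeven
import Summits.BirchSwinnertonDyer.BirchSwinnertonDyer.Theorems.AdditiveKolyvaginRoadBottomTransferKrizLiAtOne
import Summits.BirchSwinnertonDyer.Rank1Residual.X12.O11.RouteUHeegnerIndexLevelZero
import Summits.BirchSwinnertonDyer.Rank1Residual.X12.O11.RouteUDescentLocal
import Summits.BirchSwinnertonDyer.BirchSwinnertonDyer.Theorems.GoldfeldAllTwistsTwoConverseTwinGenusRankOne
import Literature.NumberTheory.EllipticCurves.BinaryQuarticMinimisationPrimeProofs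
import HarnessLib

set_option linter.dupNamespace false -- namespace `…BirchSwinnertonDyer.BirchSwinnertonDyer…` is the cell's (D-0017 nested layout)
set_option autoImplicit false

/-!
# Crux `PrintCFram.BottomClassIndexLawFiveLe` (stmt-BirchSwinnertonDyer-20372), line `eisenstein-resource-bdp-line` (registry v25):
# THE GENUS-INTERNAL HEEGNER FIELD AT `p = 7`, file 2 — the `7`-PRIMITIVITY reading of Kriz–Li's unit: over a `7`-regular
# Heegner field `K` of `X₀(49)` the Heegner point `P_K` has `ord₇ log_ω P_K = 0`, is NOT `7`-divisible in `X₀(49)(K)` nor in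
# `X₀(49)(ℚ₇)`, and `7 ∤ [X₀(49)(K) : ℤP_K]` — with Kriz–Li's Remark 3.10 DISCHARGED at an additive prime `p ≥ 5`
# (cell `bsd-print-cfram`, width seat `bsd-line-cfram-p1-w6` g8; THEOREMS ONLY, `--supports` 20372; BSD is not proved by any of this)

HONEST FRAMING. Nothing here is a statement about BSD; no stub of the registered skeleton is closed and the registry is unchanged.
File 1 (`…GenusInternalHeegnerSeven`, p702209) read Kriz–Li Thm. 1.20 at `(X₀(49) = cm7, 7, ψ = ω²)` over a `7`-REGULAR imaginary
quadratic Heegner field `K` as «`P_K` has infinite order». This file reads the SAME unit `(|Ẽ^{ns}(𝔽₇)|/7)·log_{ω_E} P_K ≢ 0 (mod 7)`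
in the stronger currencies the genus-internal branch consumes (critic V#146b (1): «unit log ⟹ `P_K` is `7`-primitive» is one of the two
inputs of the Heegner-index identity `X11b.IndexIdentityAt cm7 7 K P`; w4 g15's named fallback road, 2026-08-29T06:10:59Z):

* §1 GENERIC, at an ADDITIVE prime `p ≥ 5` of a globally minimal `W/ℚ`, for ANY `P ∈ E(K)` and any integer `c` with `p ∤ c`:
  `|Ẽ^{ns}(𝔽_p)| = p` (SchneiderFree cell, `nsPointCount_eq_self_of_addv`) and `log_ω` is `p`-integral on `E(K)` (bsd-cm
  `RouteU.norm_padicLogOmega_le_one_of_addv`: Kodaira–Néron `c_p ≤ 4 < p`, Kim's Lemma 3.10 regime), so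
  **`‖(|Ẽ^{ns}(𝔽_p)|/p)·log_ω P/c‖_p ≤ 1` WITHOUT Kriz–Li's Remark 3.10** (`norm_nsCountLog_le_one_of_addv`; bsd-cm's ROUTE U took
  the named fact `KrizLi2019.rem310_padicLogHeegner_integral` for this step — at an additive `p ≥ 5` with `p ∤ c` it is a tree theorem);
  hence Thm. 1.20's printed «`≢ 0 (mod p)`» (`¬ ‖·‖ ≤ p⁻¹`) IS «is a `p`-adic unit» (`norm_nsCountLog_eq_one_of_not_le_inv_of_addv`),
  `ord_p log_ω P = 0` (`padicLogOrd_eq_zero_of_not_le_inv_of_addv`), `P ∉ p·E(K)` (`not_exists_zsmul_eq_of_not_le_inv_of_addv`,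
  bsd-wall `AdditiveKoly.one_le_padicLogOrd_of_zsmul_eq`), `P_ι ∉ p·E(ℚ_p)` and `p ∤ [E(K) : ℤP]` given `E(K)[p] = 0`
  (O5 `HeegnerLogTransport.padicPointOf_ne_nsmul_of_padicLogOrd_eq_zero` / `padicValNat_index_eq_zero_of_padicLogOrd_eq_zero`).
* §2 AT `(cm7, 7, ψ = ω², K)` with an EXPLICIT Heegner datum `(N = N(X₀(49)), D, H, ι, ιp, P)` and `7 ∤ c(D)`: Kriz–Li's conclusion from
  the class regularity (file 1's `bernoulli_hypothesis_cm7_of_regular`), then the five readings above; `Addv cm7 7` from CM by `ℚ(√−7)`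
  (`X12.addv_of_hasCM_of_cmRamified`), `cm7(K)[7] = 0` from bsd-cm's Mazur step (`RouteU.noSevenTorsion_baseChange_of_twist_cm7` at the
  trivial twist, `completeSquare_smul_cm7`). Headline: **`padicValNat_index_heegnerPoint_cm7_eq_zero_of_regular`** — `7 ∤ [X₀(49)(K) : ℤP]`
  for every `7`-regular Heegner field `K` of `X₀(49)` and every Heegner point `P` of a parametrisation with `7 ∤ c` (Manin), granted KL19
  Thm. 1.20: the right-hand side of `X11b.IndexIdentityAt cm7 7 K P` vanishes.

What this does NOT do: the Ш-side of the identity (`Ш(cm7/K)[7] = 0`), the identity itself, any display to `BSDp`, anything at `7 ∣ c`.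
beyond-print theorem: NO (Kriz–Li Thm. 1.20 / Rem. 1.17 bookkeeping with Silverman IV.6.4, VII.6.3, Kodaira–Néron and Mazur's step;
the observation «Rem. 3.10 is free at an additive `p ≥ 5` with `p ∤ c`» is folklore-level).

References: D. Kriz, C. Li, Forum Math. Sigma 7 (2019) e15, Thm. 1.20, Rem. 1.17, Rem. 1.21, Rem. 3.10, §10.3 [KrizLi2019]; J. Silverman,
AEC IV.6.4, VII.3.1, VII.6.3 [SilvermanAEC2009]; J. Silverman, ATAEC Cor. IV.9.2 (d) [SilvermanATAEC1994]; C.-H. Kim, Lemma 3.10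
[Kim2022StructureSelmer]; B. Mazur, Modular curves and the Eisenstein ideal, III §5 Step 1 [Mazur1977]; F. Castella, Camb. J. Math. 6 (2018)
§2.2 [Castella2018]; critic verdicts V#146/V#146b (run/shared/lean/pub/ladder-directors/REQUESTS.md 2026-08-29T05:26:28Z / 05:37:55Z).
-/

noncomputable section

open scoped Classical

open WeierstrassCurve NumberField DirichletCharacter
open Literature.NumberTheory Literature.NumberTheory.EllipticCurves
  Literature.NumberTheory.EllipticCurves.ModularForms
open Literature.NumberTheory.EllipticCurves.KrizLi2019 Literature.NumberTheory.LFunctions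
open Literature.NumberTheory.EllipticCurves.Rank1Residual (Addv)
open Summit.BirchSwinnertonDyer.Rank1Residual
open Summit.BirchSwinnertonDyer.Rank1Residual.X12.O11.RouteU
open Summit.BirchSwinnertonDyer.BirchSwinnertonDyer.Theorems.GoldfeldGoodTwists

namespace Summit.BirchSwinnertonDyer.BirchSwinnertonDyer.Theorems.PrintCFram.GenusInternal

open Summit.BirchSwinnertonDyer.BirchSwinnertonDyer.Theorems.PrintCFram
open Summit.BirchSwinnertonDyer.BirchSwinnertonDyer.Theorems (AdditiveKoly.one_le_padicLogOrd_of_zsmul_eq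
  AdditiveKoly.not_dvd_localTamagawaNumber_padic_of_addv_of_five_le' SchneiderFree.nsPointCount_eq_self_of_addv)

/-! ## §1 Kriz–Li's normalised logarithm at an ADDITIVE prime `p ≥ 5`: Remark 3.10 is free, and the unit readings -/

section Additive

variable (W : WeierstrassCurve ℚ) [W.IsElliptic] [W.IsGloballyMinimal] (p : ℕ) [hp : Fact p.Prime]
  {K : Type} [Field K] [NumberField K] (ιp : K →+* ℚ_[p]) (P : (W.baseChange K).toAffine.Point)

/-- **Remark 3.10 is FREE at an additive prime `p ≥ 5` with `p ∤ c`:** for `W/ℚ` globally minimal with `Addv W p`, `5 ≤ p`, any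
number field `K ↪ ℚ_p`, ANY `P ∈ E(K)` and any integer `c` prime to `p`,
`‖(|Ẽ^{ns}(𝔽_p)|/p) · (log_{ω_𝓔} P / c)‖_p ≤ 1` — because `|Ẽ^{ns}(𝔽_p)| = p` (Kriz–Li Rem. 1.17; SchneiderFree cell
`nsPointCount_eq_self_of_addv`) and `log_{ω_𝓔}` is `p`-integral on `E(K)` (bsd-cm `RouteU.norm_padicLogOmega_le_one_of_addv`:
Kodaira–Néron `c_p ≤ 4 < p`, Kim's Lemma 3.10 regime). This is the conclusion of the named fact `KrizLi2019.rem310_padicLogHeegner_integral`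
in this regime, for every point (not only Heegner points), as a tree theorem. [cite: KrizLi2019, Rem. 1.17 (p. 6) and Rem. 3.10 (p. 26)]
[cite: Kim2022StructureSelmer, Lemma 3.10 (PDF pp. 16–17)] [cite: SilvermanATAEC1994, Cor. IV.9.2 (d)] -/
theorem norm_nsCountLog_le_one_of_addv (hadd : Addv W p) (hp5 : 5 ≤ p) {c : ℤ} (hc : ¬ (p : ℤ) ∣ c) :
    ‖((nsPointCount W p : ℤ) : ℚ_[p]) / (p : ℚ_[p]) *
        (Castella2018.padicLogOmega W p ιp P / (c : ℚ_[p]))‖ ≤ 1 := by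
  have hp0 : (p : ℚ_[p]) ≠ 0 := Nat.cast_ne_zero.mpr hp.out.ne_zero
  rw [SchneiderFree.nsPointCount_eq_self_of_addv hadd, Int.cast_natCast, div_self hp0, one_mul, norm_div,
    BinaryQuartic.norm_intCast_eq_one (p := p) hc, div_one]
  exact norm_padicLogOmega_le_one_of_addv W p hadd hp5 ιp P

/-- **Thm. 1.20's «`≢ 0 (mod p)`» IS «is a `p`-adic unit» at an additive `p ≥ 5` with `p ∤ c`:**
`¬ ‖(|Ẽ^{ns}(𝔽_p)|/p)·log_ω P/c‖ ≤ p⁻¹ ⟹ ‖(|Ẽ^{ns}(𝔽_p)|/p)·log_ω P/c‖ = 1` (integrality from `norm_nsCountLog_le_one_of_addv`,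
then the tree's `PadicQuadratic.norm_eq_one_of_not_le`) — bsd-cm's `KrizLi2019.norm_eq_one_of_rem310` WITHOUT the Rem. 3.10 binder.
[cite: KrizLi2019, Thm. 1.20 (p. 8) and Rem. 3.10 (p. 26)] -/
theorem norm_nsCountLog_eq_one_of_not_le_inv_of_addv (hadd : Addv W p) (hp5 : 5 ≤ p) {c : ℤ} (hc : ¬ (p : ℤ) ∣ c)
    (h : ¬ ‖((nsPointCount W p : ℤ) : ℚ_[p]) / (p : ℚ_[p]) *
        (Castella2018.padicLogOmega W p ιp P / (c : ℚ_[p]))‖ ≤ (p : ℝ)⁻¹) :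
    ‖((nsPointCount W p : ℤ) : ℚ_[p]) / (p : ℚ_[p]) *
        (Castella2018.padicLogOmega W p ιp P / (c : ℚ_[p]))‖ = 1 :=
  Literature.NumberTheory.QuadraticFields.PadicQuadratic.norm_eq_one_of_not_le
    (norm_nsCountLog_le_one_of_addv W p ιp P hadd hp5 hc) h

/-- **`ord_p log_{ω_𝓔} P = 0`** from Thm. 1.20's unit at an additive `p ≥ 5` with `p ∤ c`: the unit statement in `ord_p` bookkeeping
(`KrizLi2019.padicLogOrd_eq_of_norm_eq_one`: `ord_p|Ẽ^{ns}| − 1 + ord_p log_{ω_𝓔} P − ord_p c = 0`) with `ord_p|Ẽ^{ns}(𝔽_p)| = ord_p p = 1`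
and `ord_p c = 0`. [cite: KrizLi2019, Rem. 1.17 (p. 6), Rem. 3.10 (p. 26), §10.3] [cite: Castella2018, §2.2 (the reading ord_p log_{ω_E} P)] -/
theorem padicLogOrd_eq_zero_of_not_le_inv_of_addv (hadd : Addv W p) (hp5 : 5 ≤ p) {c : ℤ} (hc : ¬ (p : ℤ) ∣ c)
    (h : ¬ ‖((nsPointCount W p : ℤ) : ℚ_[p]) / (p : ℚ_[p]) *
        (Castella2018.padicLogOmega W p ιp P / (c : ℚ_[p]))‖ ≤ (p : ℝ)⁻¹) :
    padicLogOrd W p ιp P = 0 := by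
  obtain ⟨-, -, -, hsum⟩ :=
    KrizLi2019.padicLogOrd_eq_of_norm_eq_one (norm_nsCountLog_eq_one_of_not_le_inv_of_addv W p ιp P hadd hp5 hc h)
  rw [SchneiderFree.nsPointCount_eq_self_of_addv hadd, padicValInt.self hp.out.one_lt,
    padicValInt.eq_zero_of_not_dvd hc] at hsum
  push_cast at hsum
  linarith

omit [W.IsGloballyMinimal] in
/-- **A point with non-zero `log_{ω_𝓔}` has infinite order** (the formal logarithm kills exactly the torsion: x11b's
`R1.logOmega_eq_zero_iff`, whose `logOmega` is `Castella2018.padicLogOmega` by `rfl`). [cite: SilvermanAEC2009, IV.6.4 and VII.6.3] -/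
theorem not_isOfFinAddOrder_of_not_norm_nsCountLog_le [W.IsGloballyMinimal] {c : ℤ}
    (h : ¬ ‖((nsPointCount W p : ℤ) : ℚ_[p]) / (p : ℚ_[p]) *
        (Castella2018.padicLogOmega W p ιp P / (c : ℚ_[p]))‖ ≤ (p : ℝ)⁻¹) :
    ¬ IsOfFinAddOrder P :=
  fun hfin ↦ padicLogOmega_ne_zero_of_not_norm_le h ((X11b.R1.logOmega_eq_zero_iff W p ιp P).mpr hfin)

/-- **`P ∉ p·E(K)`** from Thm. 1.20's unit at an additive `p ≥ 5` with `p ∤ c`: a `p`-divisible point of infinite order would have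
`ord_p log_{ω_𝓔} ≥ 1` (bsd-wall `AdditiveKoly.one_le_padicLogOrd_of_zsmul_eq`: `log_ω(pQ) = p·log_ω Q` with `log_ω Q ∈ ℤ_p`), against
`ord_p log_{ω_𝓔} P = 0`. [cite: KrizLi2019, Thm. 1.20 (p. 8), (29) (pp. 49–50)] [cite: SilvermanAEC2009, IV.6.4 and VII.6.3] -/
theorem not_exists_zsmul_eq_of_not_le_inv_of_addv (hadd : Addv W p) (hp5 : 5 ≤ p) {c : ℤ} (hc : ¬ (p : ℤ) ∣ c)
    (h : ¬ ‖((nsPointCount W p : ℤ) : ℚ_[p]) / (p : ℚ_[p]) *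
        (Castella2018.padicLogOmega W p ιp P / (c : ℚ_[p]))‖ ≤ (p : ℝ)⁻¹) :
    ¬ ∃ Q : (W.baseChange K).toAffine.Point, (p : ℤ) • Q = P := by
  rintro ⟨Q, hQ⟩
  have h1 := AdditiveKoly.one_le_padicLogOrd_of_zsmul_eq W p hp5 hadd ιp hQ
    (not_isOfFinAddOrder_of_not_norm_nsCountLog_le W p ιp P h)
  have h0 := padicLogOrd_eq_zero_of_not_le_inv_of_addv W p ιp P hadd hp5 hc h
  have e : padicLogOrd W p ιp P = X11b.padicLogOrd W p ιp P := rfl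
  omega

/-- **`P_ι ∉ p·E(ℚ_p)`** (the LOCAL reading) from Thm. 1.20's unit at an additive `p ≥ 5` with `p ∤ c`: O5's
`padicPointOf_ne_nsmul_of_padicLogOrd_eq_zero` (the `ℤ_p`-coordinate `Ψ(P_ι)` has valuation `ord_p log + ord_p c_p + ord_p|Ẽ^{ns}| − 1 = 0`),
with `p ∤ c_p` (Kodaira–Néron, `AdditiveKoly.not_dvd_localTamagawaNumber_padic_of_addv_of_five_le'`) and `|Ẽ^{ns}(𝔽_p)| = p`
(`Additive.LocalLog.reductionPointCount_of_addv`). [cite: Castella2018, proof of Thm. 2.3, (calcul) (arXiv:1704.06608 p. 6)]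
[cite: JetchevSkinnerWan2017, (7.1.5) (arXiv:1512.06894 p. 16)] [cite: SilvermanATAEC1994, Cor. IV.9.2 (d)] -/
theorem nsmul_ne_padicPointOf_of_not_le_inv_of_addv (hadd : Addv W p) (hp5 : 5 ≤ p) {c : ℤ} (hc : ¬ (p : ℤ) ∣ c)
    (h : ¬ ‖((nsPointCount W p : ℤ) : ℚ_[p]) / (p : ℚ_[p]) *
        (Castella2018.padicLogOmega W p ιp P / (c : ℚ_[p]))‖ ≤ (p : ℝ)⁻¹)
    (Q : (W.baseChange ℚ_[p]).toAffine.Point) : p • Q ≠ X11b.padicPointOf W p ιp P :=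
  O5.HeegnerLogTransport.padicPointOf_ne_nsmul_of_padicLogOrd_eq_zero W p ιp P
    (O5.HeegnerLogTransport.not_isOfFinAddOrder_padicPointOf W p ιp P
      (not_isOfFinAddOrder_of_not_norm_nsCountLog_le W p ιp P h))
    (AdditiveKoly.not_dvd_localTamagawaNumber_padic_of_addv_of_five_le' W p hp5 hadd)
    (by rw [Additive.LocalLog.reductionPointCount_of_addv W p hadd, padicValNat_self])
    (padicLogOrd_eq_zero_of_not_le_inv_of_addv W p ιp P hadd hp5 hc h) Q

/-- **`p ∤ [E(K) : ℤP]`** from Thm. 1.20's unit at an additive `p ≥ 5` with `p ∤ c`, when `E(K)[p] = 0`: O5's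
`padicValNat_index_eq_zero_of_padicLogOrd_eq_zero` (local non-divisibility + no `p`-torsion ⟹ the index of `ℤP` is prime to `p`; an
infinite index reads `0`). This is the RIGHT-HAND side `2·ord_p [E(K) : ℤP] = 0` of x11b's `IndexIdentityAt W p K P`.
[cite: KrizLi2019, Thm. 1.20 (p. 8) and §10.3 (the index from the logarithm)] [cite: GrossLMS1991, §2 Conj. (2.2)] -/
theorem padicValNat_index_eq_zero_of_not_le_inv_of_addv (hadd : Addv W p) (hp5 : 5 ≤ p) {c : ℤ} (hc : ¬ (p : ℤ) ∣ c)
    (htors : ∀ R : (W.baseChange K).toAffine.Point, p • R = 0 → R = 0)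
    (h : ¬ ‖((nsPointCount W p : ℤ) : ℚ_[p]) / (p : ℚ_[p]) *
        (Castella2018.padicLogOmega W p ιp P / (c : ℚ_[p]))‖ ≤ (p : ℝ)⁻¹) :
    padicValNat p (AddSubgroup.zmultiples P).index = 0 :=
  O5.HeegnerLogTransport.padicValNat_index_eq_zero_of_padicLogOrd_eq_zero W p hadd ιp P
    (not_isOfFinAddOrder_of_not_norm_nsCountLog_le W p ιp P h)
    (AdditiveKoly.not_dvd_localTamagawaNumber_padic_of_addv_of_five_le' W p hp5 hadd) htors
    (padicLogOrd_eq_zero_of_not_le_inv_of_addv W p ιp P hadd hp5 hc h)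

end Additive

/-! ## §2 At `(X₀(49), 7, ψ = ω²)` over a `7`-regular Heegner field, with an explicit Heegner datum -/

section CM7

/-- **`X₀(49)` is ADDITIVE at `7`** in the cell's `Addv` currency (CM by `ℚ(√−7)`: `j = −3375`, `7 ∣ d = −7`;
`X12.addv_of_hasCM_of_cmRamified`). [cite: SilvermanATAEC1994, Thm. II.6.4] [cite: SilvermanAEC2009, Cor. VII.7.2] -/
theorem addv_cm7_seven : Addv cm7 7 := by
  refine X12.addv_of_hasCM_of_cmRamified cm7 7 hasCM_cm7' (by norm_num) ?_
  rw [Rank1Residual.CMRamified, j_cm7]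
  norm_num [Rank1Residual.cmFieldDiscrOfJ]

/-- **`X₀(49)(K)[7] = 0` for every number field `K ↪ ℚ₇`** — bsd-cm's Mazur step at the additive prime `7`
(`RouteU.noSevenTorsion_baseChange_of_twist_cm7`) at the trivial twist `X₀(49) ≅ X₀(49)^{(1)}` (`completeSquare_smul_cm7`).
[cite: Mazur1977, Ch. III §5, Step 1 (p. 158)] [cite: SilvermanAEC2009, VII.3 Prop. 3.1] -/
theorem noSevenTorsion_cm7_baseChange (K : Type) [Field K] [NumberField K]
    (ιp : K →+* ℚ_[7]) :
    ∀ x : (cm7.baseChange K).toAffine.Point, 7 • x = 0 → x = 0 :=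
  noSevenTorsion_baseChange_of_twist_cm7 cm7 (D := 1) one_ne_zero
    ⟨_, by rw [Int.cast_one]; exact completeSquare_smul_cm7⟩ K ιp

/-- **Kriz–Li's conclusion at `(X₀(49), 7, ψ = ω²)` for an EXPLICIT Heegner datum over a `7`-regular Heegner field.** `K` imaginary
quadratic with the Heegner hypothesis for `N = N(X₀(49))` (`= 49`), `ε_K` its Kronecker character, `χ` any primitive character of level
`m ⊥ 7` agreeing with `ε_K` off a finite set with `7 ∤ B_{5,χ}/5`; a parametrisation datum `D` at level `N(X₀(49))`, a Heegner datum `H`,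
`ι : K → ℂ`, `ιp : K → ℚ₇`, and `P ∈ X₀(49)(K)` with `ι(P) = heegnerPointComplex D H`. Then, granted Thm. 1.20,
`¬ ‖(|Ẽ^{ns}(𝔽₇)|/7) · log_{ω_𝓔} P / c(D)‖₇ ≤ 7⁻¹`. (File 1's instantiation with the datum kept explicit; the Bernoulli pair by
`bernoulli_hypothesis_cm7_of_regular`.) [cite: KrizLi2019, Thm. 1.20 (pp. 7–8) = Thm. 7.1, Rem. 1.21 (p. 8)] [cite: Washington1997, Thm. 5.11 and Cor. 5.13] -/
theorem not_norm_nsCountLog_le_heegnerPoint_cm7_of_regular (h120 : thm120_padicLogHeegner_unit_of_bernoulli)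
    (K : Type) [Field K] [NumberField K] (hK : IsImaginaryQuadratic K)
    (hH : SatisfiesHeegnerHypothesis (cm7.conductorNorm ℤ) K)
    (εK : DirichletCharacter ℚ_[7] (NumberField.discr K).natAbs)
    (hεK : IsKroneckerCharacterOf K εK)
    {m : ℕ} [NeZero m] (χ : DirichletCharacter ℚ_[7] m)
    (hχ : χ.IsPrimitive) (hm7 : m.Coprime 7) {N₀ : ℕ} (hN₀ : N₀ ≠ 0)
    (hχε : ∀ ℓ : ℕ, ℓ.Prime → ¬ ℓ ∣ N₀ → χ (ℓ : ZMod m) = εK (ℓ : ZMod (NumberField.discr K).natAbs))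
    (hreg : ¬ ‖(5 : ℚ_[7])⁻¹ * generalizedBernoulli 5 χ‖ ≤ (7 : ℝ)⁻¹)
    [NeZero (cm7.conductorNorm ℤ)] (D : ModularParametrizationData cm7 (cm7.conductorNorm ℤ))
    (H : HeegnerDatum (cm7.conductorNorm ℤ) (NumberField.discr K)) (ι : K →+* ℂ)
    (ιp : K →+* ℚ_[7])
    (P : (cm7.baseChange K).toAffine.Point)
    (hPH : WeierstrassCurve.Affine.Point.map ι.toRatAlgHom P = heegnerPointComplex D H) :
    ¬ ‖((nsPointCount cm7 7 : ℤ) : ℚ_[7]) / ((7 : ℕ) : ℚ_[7]) *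
        (Castella2018.padicLogOmega cm7 7 ιp P / (D.maninConstant : ℚ_[7]))‖ ≤ ((7 : ℕ) : ℝ)⁻¹ := by
  haveI : NeZero (NumberField.discr K).natAbs := ⟨Int.natAbs_ne_zero.mpr (NumberField.discr_ne_zero K)⟩
  have h7K : ((Ideal.span {((7 : ℕ) : ℤ)}).primesOver (𝓞 K)).ncard = 2 :=
    hH 7 (by norm_num) (by rw [conductorNorm_cm7]; norm_num)
  obtain ⟨ω, hω⟩ := exists_isTeichmullerCharacter (p := 7)
  have key := h120 7 (by norm_num) cm7 7 (ω ^ 2) ω (teichmuller_sq_isPrimitive ω hω) hω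
    (hss_cm7_teichmuller_sq ω hω) (teichmuller_sq_apply_seven_ne_one ω)
    (primVal_invMulOmega_teichmuller_sq_seven_ne_one ω hω)
    (not_hasSplitMultiplicativeReductionAtPrime_of_hasCM cm7 hasCM_cm7')
    (fun ℓ hℓ h7 hbad => by
      haveI := Fact.mk hℓ
      exact absurd (hasGoodReductionAtPrime_cm7 ℓ h7) hbad.1)
    D K hK hH h7K εK hεK H ι ιp P hPH
    (bernoulli_hypothesis_cm7_of_regular ω hω εK χ hχ hm7 hN₀ hχε hreg)
  exact key

/-- **The unit form: `‖(|Ẽ^{ns}(𝔽₇)|/7) · log_{ω_𝓔} P / c‖₇ = 1`** for the datum of `not_norm_nsCountLog_le_heegnerPoint_cm7_of_regular` when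
`7 ∤ c(D)` — Kriz–Li's «`log_{ω_E} P_K` is a `7`-adic unit», with Remark 3.10 discharged by §1 (`X₀(49)` is additive at `7 ≥ 5`).
[cite: KrizLi2019, Thm. 1.20 (p. 8), Rem. 3.10 (p. 26)] -/
theorem norm_nsCountLog_heegnerPoint_cm7_eq_one_of_regular (h120 : thm120_padicLogHeegner_unit_of_bernoulli)
    (K : Type) [Field K] [NumberField K] (hK : IsImaginaryQuadratic K)
    (hH : SatisfiesHeegnerHypothesis (cm7.conductorNorm ℤ) K)
    (εK : DirichletCharacter ℚ_[7] (NumberField.discr K).natAbs)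
    (hεK : IsKroneckerCharacterOf K εK)
    {m : ℕ} [NeZero m] (χ : DirichletCharacter ℚ_[7] m)
    (hχ : χ.IsPrimitive) (hm7 : m.Coprime 7) {N₀ : ℕ} (hN₀ : N₀ ≠ 0)
    (hχε : ∀ ℓ : ℕ, ℓ.Prime → ¬ ℓ ∣ N₀ → χ (ℓ : ZMod m) = εK (ℓ : ZMod (NumberField.discr K).natAbs))
    (hreg : ¬ ‖(5 : ℚ_[7])⁻¹ * generalizedBernoulli 5 χ‖ ≤ (7 : ℝ)⁻¹)
    [NeZero (cm7.conductorNorm ℤ)] (D : ModularParametrizationData cm7 (cm7.conductorNorm ℤ))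
    (H : HeegnerDatum (cm7.conductorNorm ℤ) (NumberField.discr K)) (ι : K →+* ℂ)
    (ιp : K →+* ℚ_[7])
    (P : (cm7.baseChange K).toAffine.Point)
    (hPH : WeierstrassCurve.Affine.Point.map ι.toRatAlgHom P = heegnerPointComplex D H)
    (hc : ¬ (7 : ℤ) ∣ D.maninConstant) :
    ‖((nsPointCount cm7 7 : ℤ) : ℚ_[7]) / ((7 : ℕ) : ℚ_[7]) *
        (Castella2018.padicLogOmega cm7 7 ιp P / (D.maninConstant : ℚ_[7]))‖ = 1 := by
  have hc' : ¬ ((7 : ℕ) : ℤ) ∣ D.maninConstant := by exact_mod_cast hc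
  exact norm_nsCountLog_eq_one_of_not_le_inv_of_addv cm7 7 ιp P addv_cm7_seven (by norm_num) hc'
    (not_norm_nsCountLog_le_heegnerPoint_cm7_of_regular h120 K hK hH εK hεK χ hχ hm7 hN₀ hχε hreg D H ι ιp P hPH)

/-- **`ord₇ log_{ω_𝓔} P_K = 0`** for the Heegner point of the datum (`7 ∤ c`), `K` a `7`-regular Heegner field of `X₀(49)`, granted
Thm. 1.20. [cite: KrizLi2019, Thm. 1.20 (p. 8), Rem. 1.17 (p. 6), §10.3] [cite: Castella2018, §2.2] -/
theorem padicLogOrd_heegnerPoint_cm7_eq_zero_of_regular (h120 : thm120_padicLogHeegner_unit_of_bernoulli)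
    (K : Type) [Field K] [NumberField K] (hK : IsImaginaryQuadratic K)
    (hH : SatisfiesHeegnerHypothesis (cm7.conductorNorm ℤ) K)
    (εK : DirichletCharacter ℚ_[7] (NumberField.discr K).natAbs)
    (hεK : IsKroneckerCharacterOf K εK)
    {m : ℕ} [NeZero m] (χ : DirichletCharacter ℚ_[7] m)
    (hχ : χ.IsPrimitive) (hm7 : m.Coprime 7) {N₀ : ℕ} (hN₀ : N₀ ≠ 0)
    (hχε : ∀ ℓ : ℕ, ℓ.Prime → ¬ ℓ ∣ N₀ → χ (ℓ : ZMod m) = εK (ℓ : ZMod (NumberField.discr K).natAbs))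
    (hreg : ¬ ‖(5 : ℚ_[7])⁻¹ * generalizedBernoulli 5 χ‖ ≤ (7 : ℝ)⁻¹)
    [NeZero (cm7.conductorNorm ℤ)] (D : ModularParametrizationData cm7 (cm7.conductorNorm ℤ))
    (H : HeegnerDatum (cm7.conductorNorm ℤ) (NumberField.discr K)) (ι : K →+* ℂ)
    (ιp : K →+* ℚ_[7])
    (P : (cm7.baseChange K).toAffine.Point)
    (hPH : WeierstrassCurve.Affine.Point.map ι.toRatAlgHom P = heegnerPointComplex D H)
    (hc : ¬ (7 : ℤ) ∣ D.maninConstant) :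
    padicLogOrd cm7 7 ιp P = 0 := by
  have hc' : ¬ ((7 : ℕ) : ℤ) ∣ D.maninConstant := by exact_mod_cast hc
  exact padicLogOrd_eq_zero_of_not_le_inv_of_addv cm7 7 ιp P addv_cm7_seven (by norm_num) hc'
    (not_norm_nsCountLog_le_heegnerPoint_cm7_of_regular h120 K hK hH εK hεK χ hχ hm7 hN₀ hχε hreg D H ι ιp P hPH)

/-- **`P_K ∉ 7·X₀(49)(K)`** — the Heegner point of the datum (`7 ∤ c`) over a `7`-regular Heegner field of `X₀(49)` is NOT
`7`-divisible in the Mordell–Weil group over `K`, granted Thm. 1.20. [cite: KrizLi2019, Thm. 1.20 (p. 8), (29) (pp. 49–50)]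
[cite: SilvermanAEC2009, IV.6.4 and VII.6.3] -/
theorem not_exists_zsmul_eq_heegnerPoint_cm7_of_regular (h120 : thm120_padicLogHeegner_unit_of_bernoulli)
    (K : Type) [Field K] [NumberField K] (hK : IsImaginaryQuadratic K)
    (hH : SatisfiesHeegnerHypothesis (cm7.conductorNorm ℤ) K)
    (εK : DirichletCharacter ℚ_[7] (NumberField.discr K).natAbs)
    (hεK : IsKroneckerCharacterOf K εK)
    {m : ℕ} [NeZero m] (χ : DirichletCharacter ℚ_[7] m)
    (hχ : χ.IsPrimitive) (hm7 : m.Coprime 7) {N₀ : ℕ} (hN₀ : N₀ ≠ 0)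
    (hχε : ∀ ℓ : ℕ, ℓ.Prime → ¬ ℓ ∣ N₀ → χ (ℓ : ZMod m) = εK (ℓ : ZMod (NumberField.discr K).natAbs))
    (hreg : ¬ ‖(5 : ℚ_[7])⁻¹ * generalizedBernoulli 5 χ‖ ≤ (7 : ℝ)⁻¹)
    [NeZero (cm7.conductorNorm ℤ)] (D : ModularParametrizationData cm7 (cm7.conductorNorm ℤ))
    (H : HeegnerDatum (cm7.conductorNorm ℤ) (NumberField.discr K)) (ι : K →+* ℂ)
    (ιp : K →+* ℚ_[7])
    (P : (cm7.baseChange K).toAffine.Point)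
    (hPH : WeierstrassCurve.Affine.Point.map ι.toRatAlgHom P = heegnerPointComplex D H)
    (hc : ¬ (7 : ℤ) ∣ D.maninConstant) :
    ¬ ∃ Q : (cm7.baseChange K).toAffine.Point, ((7 : ℕ) : ℤ) • Q = P := by
  have hc' : ¬ ((7 : ℕ) : ℤ) ∣ D.maninConstant := by exact_mod_cast hc
  exact not_exists_zsmul_eq_of_not_le_inv_of_addv cm7 7 ιp P addv_cm7_seven (by norm_num) hc'
    (not_norm_nsCountLog_le_heegnerPoint_cm7_of_regular h120 K hK hH εK hεK χ hχ hm7 hN₀ hχε hreg D H ι ιp P hPH)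

/-- **`P_ι ∉ 7·X₀(49)(ℚ₇)`** (the LOCAL reading: the Heegner point of the datum is not `7`-divisible even in `X₀(49)(K_𝔭) = X₀(49)(ℚ₇)`),
`K` a `7`-regular Heegner field of `X₀(49)`, `7 ∤ c`, granted Thm. 1.20. [cite: KrizLi2019, Thm. 1.20 (p. 8)]
[cite: Castella2018, proof of Thm. 2.3, (calcul) (arXiv:1704.06608 p. 6)] -/
theorem nsmul_ne_padicPointOf_heegnerPoint_cm7_of_regular (h120 : thm120_padicLogHeegner_unit_of_bernoulli)
    (K : Type) [Field K] [NumberField K] (hK : IsImaginaryQuadratic K)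
    (hH : SatisfiesHeegnerHypothesis (cm7.conductorNorm ℤ) K)
    (εK : DirichletCharacter ℚ_[7] (NumberField.discr K).natAbs)
    (hεK : IsKroneckerCharacterOf K εK)
    {m : ℕ} [NeZero m] (χ : DirichletCharacter ℚ_[7] m)
    (hχ : χ.IsPrimitive) (hm7 : m.Coprime 7) {N₀ : ℕ} (hN₀ : N₀ ≠ 0)
    (hχε : ∀ ℓ : ℕ, ℓ.Prime → ¬ ℓ ∣ N₀ → χ (ℓ : ZMod m) = εK (ℓ : ZMod (NumberField.discr K).natAbs))
    (hreg : ¬ ‖(5 : ℚ_[7])⁻¹ * generalizedBernoulli 5 χ‖ ≤ (7 : ℝ)⁻¹)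
    [NeZero (cm7.conductorNorm ℤ)] (D : ModularParametrizationData cm7 (cm7.conductorNorm ℤ))
    (H : HeegnerDatum (cm7.conductorNorm ℤ) (NumberField.discr K)) (ι : K →+* ℂ)
    (ιp : K →+* ℚ_[7])
    (P : (cm7.baseChange K).toAffine.Point)
    (hPH : WeierstrassCurve.Affine.Point.map ι.toRatAlgHom P = heegnerPointComplex D H)
    (hc : ¬ (7 : ℤ) ∣ D.maninConstant) :
    ∀ Q : (cm7.baseChange ℚ_[7]).toAffine.Point, 7 • Q ≠ X11b.padicPointOf cm7 7 ιp P := by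
  have hc' : ¬ ((7 : ℕ) : ℤ) ∣ D.maninConstant := by exact_mod_cast hc
  exact nsmul_ne_padicPointOf_of_not_le_inv_of_addv cm7 7 ιp P addv_cm7_seven (by norm_num) hc'
    (not_norm_nsCountLog_le_heegnerPoint_cm7_of_regular h120 K hK hH εK hεK χ hχ hm7 hN₀ hχε hreg D H ι ιp P hPH)

/-- **HEADLINE: `7 ∤ [X₀(49)(K) : ℤP_K]`** — for every `7`-REGULAR imaginary quadratic Heegner field `K` of `X₀(49)` (`7 ∤ B_{5,χ}/5` for
any primitive `χ ⊥ 7` agreeing with `ε_K` off a finite set) and every Heegner point `P ∈ X₀(49)(K)` of a parametrisation datum with `7 ∤ c`,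
granted Kriz–Li Thm. 1.20: `padicValNat 7 (AddSubgroup.zmultiples P).index = 0` — the right-hand side of `X11b.IndexIdentityAt cm7 7 K P`
(`2·ord₇∏c_ℓ + ord₇#Ш(X₀(49)/K) = 2·ord₇[X₀(49)(K) : ℤP]`) VANISHES. No certificate, no auxiliary field, no rank-one bookkeeping
(`X₀(49)(K)[7] = 0` by Mazur's step at the additive `7`). [cite: KrizLi2019, Thm. 1.20 (pp. 7–8), Rem. 1.21 (p. 8), §10.3]
[cite: GrossLMS1991, §2 Conj. (2.2)] [cite: Mazur1977, Ch. III §5, Step 1 (p. 158)] -/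
theorem padicValNat_index_heegnerPoint_cm7_eq_zero_of_regular (h120 : thm120_padicLogHeegner_unit_of_bernoulli)
    (K : Type) [Field K] [NumberField K] (hK : IsImaginaryQuadratic K)
    (hH : SatisfiesHeegnerHypothesis (cm7.conductorNorm ℤ) K)
    (εK : DirichletCharacter ℚ_[7] (NumberField.discr K).natAbs)
    (hεK : IsKroneckerCharacterOf K εK)
    {m : ℕ} [NeZero m] (χ : DirichletCharacter ℚ_[7] m)
    (hχ : χ.IsPrimitive) (hm7 : m.Coprime 7) {N₀ : ℕ} (hN₀ : N₀ ≠ 0)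
    (hχε : ∀ ℓ : ℕ, ℓ.Prime → ¬ ℓ ∣ N₀ → χ (ℓ : ZMod m) = εK (ℓ : ZMod (NumberField.discr K).natAbs))
    (hreg : ¬ ‖(5 : ℚ_[7])⁻¹ * generalizedBernoulli 5 χ‖ ≤ (7 : ℝ)⁻¹)
    [NeZero (cm7.conductorNorm ℤ)] (D : ModularParametrizationData cm7 (cm7.conductorNorm ℤ))
    (H : HeegnerDatum (cm7.conductorNorm ℤ) (NumberField.discr K)) (ι : K →+* ℂ)
    (ιp : K →+* ℚ_[7])
    (P : (cm7.baseChange K).toAffine.Point)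
    (hPH : WeierstrassCurve.Affine.Point.map ι.toRatAlgHom P = heegnerPointComplex D H)
    (hc : ¬ (7 : ℤ) ∣ D.maninConstant) :
    padicValNat 7 (AddSubgroup.zmultiples P).index = 0 := by
  have hc' : ¬ ((7 : ℕ) : ℤ) ∣ D.maninConstant := by exact_mod_cast hc
  exact padicValNat_index_eq_zero_of_not_le_inv_of_addv cm7 7 ιp P addv_cm7_seven (by norm_num) hc'
    (noSevenTorsion_cm7_baseChange K ιp)
    (not_norm_nsCountLog_le_heegnerPoint_cm7_of_regular h120 K hK hH εK hεK χ hχ hm7 hN₀ hχε hreg D H ι ιp P hPH)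

end CM7

end Summit.BirchSwinnertonDyer.BirchSwinnertonDyer.Theorems.PrintCFram.GenusInternal

end
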